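import Literature.Probability.LatticeModels.RandomCurrentsProofs
import Mathlib.Analysis.SpecialFunctions.Trigonometric.Series
import Mathlib.Analysis.SpecialFunctions.Trigonometric.DerivHyp
import HarnessLib

/-!
# The insertion map of Aizenman–Duminil-Copin–Sidoravicius: resetting sources along a path

Trunk G02 (T-STATMECH), topic `Probability/LatticeModels`, namespace `Literature.StatMech`
(dot-notation extensions in `Literature.Probability.LatticeModels.Current`). This file proves the current-weight
inequality behind eqs. (3.8)–(3.9) of

* M. Aizenman, H. Duminil-Copin, V. Sidoravicius, *Random currents and continuity of Ising
  model's spontaneous magnetization*, Comm. Math. Phys. **334** (2015) 719–742, §3.2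
  (arXiv:1311.1937v3 numbering; bib key `AizenmanDuminilCopinSidoraviciusCMP2015`, "ADS15"):

  "Fix a sequence of vertices `x = x_0, …, x_m = y` with `J_{x_i,x_{i+1}} > 0` … consider the
  one-to-many mapping which assigns to each `ω` a modified current configuration `n₂` with the
  change limited to `n₂` along the set of bonds `e_j = {x_j, x_{j+1}}`, at which the parity of
  all these variables is flipped, and the value of the new one is at least `1` at each bond. Under
  this mapping, the image of each pair `(n₁,n₂)` … lies in the set for which the connection event
  `x ↔ δ` remains satisfied, but the source set of `n₂` is reset to `∂n₂ = ∅`. Classifying the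
  current pairs according to the values of all the unaffected variables and the parity of `n₂`
  along `e_0, …, e_{m-1}`, … the measure of each set is multiplied by a factor which is larger
  than or equal to `Γ_{x,y} = ∏_j min{tanh(βJ_{e_j}), (cosh(βJ_{e_j}) - 1)/sinh(βJ_{e_j})}`."

## Statement

For a finite graph `G`, a volume `Λ` (sources prescribed inside `Λ` only, as for the `+` current
of `DoubleCurrents.lean` — `adsPairWeight`: `∂n₂ ∩ Λ_L = ∅` — and of `PlusCurrents.lean`), `β > 0`, and a functional `E` of the current with `0 ≤ E ≤ 1` which is
**increasing in the trace** (`n̂ ⊆ n̂' ⇒ E(n) ≤ E(n')`; e.g. the indicator of an increasing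
connection event of `n̂₁ ∪ n̂`, `n₁` fixed), and a walk `x = x_0 ∼ x_1 ∼ ⋯ ∼ x_k = y` in `G`:

`∑_{n : ∂n ∩ Λ = S} w_β(n) E(n) ≤ tanh(β/2)^{-k} ∑_{n : ∂n ∩ Λ = S Δ (({x} Δ {y}) ∩ Λ)} w_β(n) E(n)`

(`Current.tsum_ite_sources_le_of_walk`; unit couplings, so `min{tanh β, tanh(β/2)} = tanh(β/2)`).
With `S = {x} Δ {y} ⊆ Λ` the right-hand constraint is `∂n ∩ Λ = ∅`: this is ADS15 (3.9) for the
`n₂`-sum at fixed `n₁`.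

## Proof

One edge at a time (`Current.tsum_ite_sources_le_of_edge`): split `n = (k, r)` into its value `k`
on the edge `e = {a,b}` and the rest `r` (`Current.splitAt`); `w(n) = (β^k/k!) w(r)`, the source
constraint depends on `k` only through its parity and flips with it (`∂(n + 𝟙_e) = ∂n Δ {a,b}`),
and `E` depends on `k` only through `𝟙[k > 0]`. For fixed `r` one is reduced to the scalar
inequality (`tsum_parity_mul_le`)
`∑_{k : P(k)} β^k/k! c_k ≤ coth(β/2) ∑_{k : P(k+1)} β^k/k! c_k` for `2`-periodic `P` and
`0 ≤ c_k ≤ c_1`, `c_k = c_1 (k ≥ 1)`, which follows from `∑_{k even} β^k/k! = cosh β`,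
`∑_{k odd} = sinh β` (`Real.hasSum_cosh/sinh`) and the half-angle identities
`sinh β = tanh(β/2)(cosh β + 1)`, `cosh β - 1 = tanh(β/2) sinh β` — the two cases of ADS15's
`min{sinh/cosh, (cosh-1)/sinh}`.

## Mathlib status

Anchors: `Real.hasSum_cosh`, `Real.hasSum_sinh`, `HasSum.even_add_odd`, `hasSum_pi_single`,
`Real.sinh_two_mul`, `Real.cosh_two_mul`, `Real.cosh_sq`, `Function.update`,
`Equiv.tsum_eq`, `Summable.tsum_prod`, `Summable.tsum_le_tsum`, `inf_symmDiff_distrib_right`,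
`SimpleGraph.Walk` induction; tree: `Current.symmDiff_singleton_eq_pair`, `Current.sources_add`
(`RandomCurrents(Proofs).lean`).
-/

noncomputable section

open MeasureTheory Finset Filter Topology
open scoped symmDiff Nat

namespace Literature.Probability.LatticeModels

/-! ### Parity series -/

/-- Half-angle identity `sinh β = tanh(β/2) (cosh β + 1)` (the case `tanh` of ADS15's `Γ`:
`sinh β / cosh β ≥ tanh(β/2)`, indeed `coth(β/2) sinh β = cosh β + 1 ≥ cosh β`). [folklore] -/
theorem Real.sinh_eq_tanh_half_mul (β : ℝ) :
    Real.sinh β = Real.tanh (β / 2) * (Real.cosh β + 1) := by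
  have h2 : β = 2 * (β / 2) := by ring
  conv_lhs => rw [h2, Real.sinh_two_mul]
  conv_rhs => rw [h2, Real.cosh_two_mul]
  rw [Real.tanh_eq_sinh_div_cosh, Real.sinh_sq]
  field_simp
  ring

/-- Half-angle identity `cosh β - 1 = tanh(β/2) sinh β` (the case `(cosh - 1)/sinh = tanh(β/2)`
of ADS15's `Γ`). [folklore] -/
theorem Real.cosh_sub_one_eq_tanh_half_mul (β : ℝ) :
    Real.cosh β - 1 = Real.tanh (β / 2) * Real.sinh β := by
  have h2 : β = 2 * (β / 2) := by ring
  conv_lhs => rw [h2, Real.cosh_two_mul]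
  conv_rhs => rw [h2, Real.sinh_two_mul]
  rw [Real.tanh_eq_sinh_div_cosh, Real.cosh_sq]
  field_simp
  ring

/-- `tanh(β/2) > 0` for `β > 0`. [folklore] -/
theorem Real.tanh_half_pos {β : ℝ} (hβ : 0 < β) : 0 < Real.tanh (β / 2) := by
  rw [Real.tanh_eq_sinh_div_cosh]
  exact div_pos (Real.sinh_pos_iff.2 (by linarith)) (Real.cosh_pos _)

/-- A `2`-periodic predicate is determined by its values at `0` and `1`. [folklore] -/
theorem periodic_two_iff (P : ℕ → Prop) (hP : ∀ k, P (k + 2) ↔ P k) (k : ℕ) :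
    P k ↔ (Even k ∧ P 0 ∨ Odd k ∧ P 1) := by
  have key : ∀ j, (P (2 * j) ↔ P 0) ∧ (P (2 * j + 1) ↔ P 1) := by
    intro j
    induction j with
    | zero => simp
    | succ j ih =>
      constructor
      · rw [show 2 * (j + 1) = 2 * j + 2 by ring, hP]; exact ih.1
      · rw [show 2 * (j + 1) + 1 = (2 * j + 1) + 2 by ring, hP]; exact ih.2
  rcases Nat.even_or_odd k with ⟨j, rfl⟩ | ⟨j, rfl⟩
  · have h := (key j).1
    rw [two_mul] at h
    simp [h, Nat.not_odd_iff_even.2 (Even.add_self j)]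
  · have h := (key j).2
    simp [h, Nat.not_even_iff_odd.2 (odd_two_mul_add_one j)]

/-- **The scalar insertion inequality** (ADS15 §3.2, the factor `Γ` of (3.9), one bond of unit
coupling): for `β > 0`, a `2`-periodic constraint `P` on the value `k` of the current on the bond,
and coefficients `0 ≤ c_k ≤ c_1` with `c_k = c_1` for `k ≥ 1` (a functional of the trace),
`∑_{k : P(k)} β^k/k! c_k ≤ tanh(β/2)⁻¹ ∑_{k : P(k+1)} β^k/k! c_k`: the left side is at most
`c_1 (p_0 cosh β + p_1 sinh β)`, the right sum at least `c_1 (p_1 (cosh β - 1) + p_0 sinh β)`, and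
`coth(β/2) (cosh β - 1) = sinh β`, `coth(β/2) sinh β = cosh β + 1`. [cite: AizenmanDuminilCopinSidoraviciusCMP2015, §3.2, eq. (3.9)] -/
theorem tsum_parity_mul_le {β : ℝ} (hβ : 0 < β) (P : ℕ → Prop) [DecidablePred P]
    (hP : ∀ k, P (k + 2) ↔ P k) (c : ℕ → ℝ) (hc0 : ∀ k, 0 ≤ c k) (hc1 : ∀ k, c k ≤ c 1)
    (hc2 : ∀ k, 1 ≤ k → c 1 ≤ c k) :
    ∑' k, (if P k then β ^ k / (k ! : ℝ) * c k else 0) ≤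
      (Real.tanh (β / 2))⁻¹ * ∑' k, (if P (k + 1) then β ^ k / (k ! : ℝ) * c k else 0) := by
  set u : ℕ → ℝ := fun k => β ^ k / (k ! : ℝ) with hu
  have hu0 : ∀ k, 0 ≤ u k := fun k => by positivity
  set p0 : ℝ := if P 0 then 1 else 0 with hp0
  set p1 : ℝ := if P 1 then 1 else 0 with hp1
  have hp0nn : 0 ≤ p0 := by rw [hp0]; split_ifs <;> norm_num
  have hp1nn : 0 ≤ p1 := by rw [hp1]; split_ifs <;> norm_num
  have hc1nn : 0 ≤ c 1 := hc0 1
  have hPk := periodic_two_iff P hP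
  -- indicator of `P k` and of `P (k+1)` in terms of the parity of `k`
  have hind : ∀ k, (if P k then (1 : ℝ) else 0) = if Even k then p0 else p1 := by
    intro k
    rcases Nat.even_or_odd k with he | ho
    · rw [if_pos he, hp0]
      by_cases h0 : P 0
      · rw [if_pos h0, if_pos ((hPk k).2 (Or.inl ⟨he, h0⟩))]
      · rw [if_neg h0, if_neg]
        intro hk
        rcases (hPk k).1 hk with ⟨_, h⟩ | ⟨ho, _⟩
        · exact h0 h
        · exact (Nat.not_odd_iff_even.2 he) ho
    · rw [if_neg (Nat.not_even_iff_odd.2 ho), hp1]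
      by_cases h1 : P 1
      · rw [if_pos h1, if_pos ((hPk k).2 (Or.inr ⟨ho, h1⟩))]
      · rw [if_neg h1, if_neg]
        intro hk
        rcases (hPk k).1 hk with ⟨he, _⟩ | ⟨_, h⟩
        · exact (Nat.not_even_iff_odd.2 ho) he
        · exact h1 h
  have hind' : ∀ k, (if P (k + 1) then (1 : ℝ) else 0) = if Even k then p1 else p0 := by
    intro k
    rw [hind (k + 1)]
    rcases Nat.even_or_odd k with he | ho
    · rw [if_pos he, if_neg (Nat.not_even_iff_odd.2 he.add_one)]
    · rw [if_neg (Nat.not_even_iff_odd.2 ho), if_pos ho.add_one]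
  -- the upper bound for the left-hand side
  set f : ℕ → ℝ := fun k => if P k then u k * c k else 0 with hf
  set g : ℕ → ℝ := fun k => (if Even k then p0 else p1) * c 1 * u k with hg
  have hfg : ∀ k, f k ≤ g k := by
    intro k
    simp only [hf, hg, ← hind k]
    by_cases hk : P k
    · rw [if_pos hk, if_pos hk]
      calc u k * c k ≤ u k * c 1 := mul_le_mul_of_nonneg_left (hc1 k) (hu0 k)
        _ = 1 * c 1 * u k := by ring
    · rw [if_neg hk, if_neg hk, zero_mul, zero_mul]
  have hf0 : ∀ k, 0 ≤ f k := fun k => by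
    simp only [hf]
    by_cases hk : P k
    · rw [if_pos hk]; exact mul_nonneg (hu0 k) (hc0 k)
    · rw [if_neg hk]
  have hgsum : HasSum g (c 1 * (p0 * Real.cosh β + p1 * Real.sinh β)) := by
    have he : HasSum (fun j => g (2 * j)) (p0 * c 1 * Real.cosh β) := by
      have hfun : (fun j => g (2 * j)) = fun j => p0 * c 1 * (β ^ (2 * j) / ((2 * j) ! : ℝ)) := by
        funext j
        simp only [hg, hu, if_pos (even_two_mul j)]
      rw [hfun]
      exact (Real.hasSum_cosh β).mul_left (p0 * c 1)
    have ho : HasSum (fun j => g (2 * j + 1)) (p1 * c 1 * Real.sinh β) := by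
      have hfun : (fun j => g (2 * j + 1)) =
          fun j => p1 * c 1 * (β ^ (2 * j + 1) / ((2 * j + 1) ! : ℝ)) := by
        funext j
        simp only [hg, hu, if_neg (Nat.not_even_iff_odd.2 (odd_two_mul_add_one j))]
      rw [hfun]
      exact (Real.hasSum_sinh β).mul_left (p1 * c 1)
    have h := he.even_add_odd ho
    rwa [show p0 * c 1 * Real.cosh β + p1 * c 1 * Real.sinh β =
      c 1 * (p0 * Real.cosh β + p1 * Real.sinh β) by ring] at h
  have hgs : Summable g := hgsum.summable
  have hfs : Summable f := Summable.of_nonneg_of_le hf0 hfg hgs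
  have hL : ∑' k, f k ≤ c 1 * (p0 * Real.cosh β + p1 * Real.sinh β) := by
    rw [← hgsum.tsum_eq]
    exact hfs.tsum_le_tsum hfg hgs
  -- the lower bound for the right-hand side
  set h : ℕ → ℝ := fun k => if P (k + 1) then u k * c k else 0 with hh
  set h' : ℕ → ℝ := fun k => (if Even k then p1 else p0) * c 1 * (u k - if k = 0 then 1 else 0)
    with hh'
  have hh'h : ∀ k, h' k ≤ h k := by
    intro k
    simp only [hh, hh', ← hind' k]
    by_cases hk : k = 0
    · subst hk
      simp only [hu, pow_zero, Nat.factorial_zero, Nat.cast_one, div_one, sub_self, mul_zero,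
        if_true]
      by_cases h1 : P (0 + 1)
      · rw [if_pos h1, one_mul]; exact hc0 0
      · rw [if_neg h1]
    · rw [if_neg hk, sub_zero]
      by_cases h1 : P (k + 1)
      · rw [if_pos h1, if_pos h1]
        calc 1 * c 1 * u k = u k * c 1 := by ring
          _ ≤ u k * c k :=
            mul_le_mul_of_nonneg_left (hc2 k (Nat.one_le_iff_ne_zero.2 hk)) (hu0 k)
      · rw [if_neg h1, if_neg h1, zero_mul, zero_mul]
  have hh'sum : HasSum h' (c 1 * (p1 * (Real.cosh β - 1) + p0 * Real.sinh β)) := by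
    have he : HasSum (fun j => h' (2 * j)) (p1 * c 1 * (Real.cosh β - 1)) := by
      have h01 : HasSum (fun j : ℕ => if j = 0 then (1 : ℝ) else 0) 1 := by
        have hfun : (fun j : ℕ => if j = 0 then (1 : ℝ) else 0) = Pi.single 0 1 := by
          funext j
          by_cases hj : j = 0
          · subst hj; simp
          · rw [if_neg hj, Pi.single_eq_of_ne hj]
        rw [hfun]
        exact hasSum_pi_single 0 1
      have hfun : (fun j => h' (2 * j)) =
          fun j => p1 * c 1 * (β ^ (2 * j) / ((2 * j) ! : ℝ) - if j = 0 then 1 else 0) := by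
        funext j
        have h2 : (2 * j = 0) = (j = 0) := by
          apply propext; omega
        simp only [hh', hu, if_pos (even_two_mul j), h2]
      rw [hfun]
      exact ((Real.hasSum_cosh β).sub h01).mul_left (p1 * c 1)
    have ho : HasSum (fun j => h' (2 * j + 1)) (p0 * c 1 * Real.sinh β) := by
      have hfun : (fun j => h' (2 * j + 1)) =
          fun j => p0 * c 1 * (β ^ (2 * j + 1) / ((2 * j + 1) ! : ℝ)) := by
        funext j
        simp only [hh', hu, if_neg (Nat.not_even_iff_odd.2 (odd_two_mul_add_one j)),
          if_neg (Nat.succ_ne_zero (2 * j)), sub_zero]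
      rw [hfun]
      exact (Real.hasSum_sinh β).mul_left (p0 * c 1)
    have h := he.even_add_odd ho
    rwa [show p1 * c 1 * (Real.cosh β - 1) + p0 * c 1 * Real.sinh β =
      c 1 * (p1 * (Real.cosh β - 1) + p0 * Real.sinh β) by ring] at h
  have hhs : Summable h := by
    refine Summable.of_nonneg_of_le (fun k => ?_) (fun k => ?_)
      ((Real.summable_pow_div_factorial β).mul_right (c 1))
    · simp only [hh]
      by_cases h1 : P (k + 1)
      · rw [if_pos h1]; exact mul_nonneg (hu0 k) (hc0 k)
      · rw [if_neg h1]
    · simp only [hh]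
      by_cases h1 : P (k + 1)
      · rw [if_pos h1]; exact mul_le_mul_of_nonneg_left (hc1 k) (hu0 k)
      · rw [if_neg h1]; exact mul_nonneg (hu0 k) hc1nn
  have hR : c 1 * (p1 * (Real.cosh β - 1) + p0 * Real.sinh β) ≤ ∑' k, h k := by
    rw [← hh'sum.tsum_eq]
    exact hh'sum.summable.tsum_le_tsum hh'h hhs
  -- combine with the half-angle identities
  have ht : 0 < Real.tanh (β / 2) := Real.tanh_half_pos hβ
  have hkey : (Real.tanh (β / 2))⁻¹ * (c 1 * (p1 * (Real.cosh β - 1) + p0 * Real.sinh β)) =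
      c 1 * (p1 * Real.sinh β + p0 * (Real.cosh β + 1)) := by
    rw [Real.cosh_sub_one_eq_tanh_half_mul, Real.sinh_eq_tanh_half_mul β]
    field_simp
  calc ∑' k, f k ≤ c 1 * (p0 * Real.cosh β + p1 * Real.sinh β) := hL
    _ ≤ c 1 * (p1 * Real.sinh β + p0 * (Real.cosh β + 1)) := by
        have : 0 ≤ c 1 * p0 := mul_nonneg hc1nn hp0nn
        nlinarith
    _ = (Real.tanh (β / 2))⁻¹ * (c 1 * (p1 * (Real.cosh β - 1) + p0 * Real.sinh β)) := hkey.symm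
    _ ≤ (Real.tanh (β / 2))⁻¹ * ∑' k, h k :=
        mul_le_mul_of_nonneg_left hR (inv_nonneg.2 ht.le)

/-! ### Splitting a current at an edge -/

variable {V : Type*} [Fintype V] [DecidableEq V] {G : SimpleGraph V} [DecidableRel G.Adj]

namespace Current

/-- Splitting a current into its value on the edge `e₀` and the current with `e₀` emptied
("classifying the currents according to the values of all the unaffected variables", ADS15 §3.2). [cite: AizenmanDuminilCopinSidoraviciusCMP2015, §3.2, eqs. (3.8)–(3.9)] -/
def splitAt (e₀ : G.edgeFinset) : Current G ≃ ℕ × {r : Current G // r e₀ = 0} where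
  toFun n := (n e₀, ⟨Function.update n e₀ 0, Function.update_self _ _ _⟩)
  invFun q := Function.update q.2.1 e₀ q.1
  left_inv n := by
    show Function.update (Function.update n e₀ 0) e₀ (n e₀) = n
    rw [Function.update_idem, Function.update_eq_self]
  right_inv q := by
    obtain ⟨k, r, hr⟩ := q
    refine Prod.ext (Function.update_self _ _ _) (Subtype.ext ?_)
    show Function.update (Function.update r e₀ k) e₀ 0 = r
    rw [Function.update_idem, Function.update_eq_self_iff]
    exact hr.symm

/-- The weight splits: `w_β(r with value k on e₀) = β^k/k! · w_β(r)` if `r(e₀) = 0`. [cite: AizenmanDuminilCopinSidoraviciusCMP2015, §3.2, eqs. (3.8)–(3.9)] -/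
theorem weight_update (e₀ : G.edgeFinset) {r : Current G} (hr : r e₀ = 0) (k : ℕ) (β : ℝ) :
    weight β (Function.update r e₀ k) = β ^ k / (k ! : ℝ) * r.weight β := by
  unfold weight
  rw [Fintype.prod_eq_mul_prod_compl e₀, Fintype.prod_eq_mul_prod_compl e₀ (fun e => β ^ r e / ((r e) ! : ℝ)),
    Function.update_self, hr]
  simp only [pow_zero, Nat.factorial_zero, Nat.cast_one, div_one, one_mul]
  congr 1
  refine Finset.prod_congr rfl fun e he => ?_
  rw [Finset.mem_compl, Finset.mem_singleton] at he
  rw [Function.update_of_ne he]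

/-- Increasing the value on `e₀` by one adds the unit current `𝟙_{e₀}`. [folklore] -/
theorem update_succ (e₀ : G.edgeFinset) (r : Current G) (k : ℕ) :
    Function.update r e₀ (k + 1) = Function.update r e₀ k + Pi.single e₀ 1 := by
  funext e
  by_cases he : e = e₀
  · subst he; simp
  · simp [Function.update_of_ne he, Pi.single_eq_of_ne he]

/-- The sources of the unit current on the edge `{a,b}` are `{a, b}`. [folklore] -/
theorem sources_single (e₀ : G.edgeFinset) {a b : V} (hab : (e₀ : Sym2 V) = s(a, b)) :
    sources (Pi.single e₀ 1 : Current G) = {a, b} := by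
  have hne : a ≠ b := by
    have he := e₀.2
    rw [hab, SimpleGraph.mem_edgeFinset] at he
    exact G.ne_of_adj he
  ext x
  rw [mem_sources_iff, degree, Finset.sum_eq_single e₀]
  · rw [Pi.single_eq_same, hab]
    simp only [Sym2.mem_iff, Finset.mem_insert, Finset.mem_singleton]
    by_cases hx : x = a ∨ x = b
    · rw [if_pos hx]; simp [hx]
    · rw [if_neg hx]; simp [hx]
  · intro e _ he
    rw [Pi.single_eq_of_ne he]; simp
  · intro h; exact absurd (Finset.mem_univ _) h

/-- **Parity flip** (ADS15 §3.2, "the parity of all these variables is flipped"): increasing the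
value on the edge `{a,b}` by one changes the sources by `Δ {a,b}`. [cite: AizenmanDuminilCopinSidoraviciusCMP2015, §3.2, eqs. (3.8)–(3.9)] -/
theorem sources_update_succ (e₀ : G.edgeFinset) {a b : V} (hab : (e₀ : Sym2 V) = s(a, b))
    (r : Current G) (k : ℕ) :
    sources (Function.update r e₀ (k + 1)) = sources (Function.update r e₀ k) ∆ {a, b} := by
  rw [update_succ, sources_add, sources_single e₀ hab]

omit [DecidableEq V] in
/-- The trace is monotone in the current. [folklore] -/
theorem traced_mono {n n' : Current G} (h : n ≤ n') : n.traced ⊆ n'.traced := by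
  rintro e ⟨hG, hpos⟩
  exact ⟨hG, lt_of_lt_of_le hpos (h _)⟩

/-- `update` is monotone in the inserted value. [folklore] -/
theorem update_mono (e₀ : G.edgeFinset) (r : Current G) {k k' : ℕ} (h : k ≤ k') :
    Function.update r e₀ k ≤ Function.update r e₀ k' := by
  intro e
  by_cases he : e = e₀
  · subst he; simpa
  · rw [Function.update_of_ne he, Function.update_of_ne he]

/-- The trace only sees whether the value on `e₀` is positive ("the value of the new one is at
least `1`", ADS15 §3.2). [cite: AizenmanDuminilCopinSidoraviciusCMP2015, §3.2, eqs. (3.8)–(3.9)] -/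
theorem traced_update_eq_of_pos (e₀ : G.edgeFinset) (r : Current G) {k k' : ℕ} (hk : 0 < k)
    (hk' : 0 < k') : traced (Function.update r e₀ k) = traced (Function.update r e₀ k') := by
  ext e
  simp only [traced, Set.mem_setOf_eq]
  constructor
  · rintro ⟨hG, hpos⟩
    refine ⟨hG, ?_⟩
    by_cases he : (⟨e, hG⟩ : G.edgeFinset) = e₀
    · rw [he, Function.update_self]; exact hk'
    · rw [Function.update_of_ne he] at hpos ⊢; exact hpos
  · rintro ⟨hG, hpos⟩
    refine ⟨hG, ?_⟩
    by_cases he : (⟨e, hG⟩ : G.edgeFinset) = e₀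
    · rw [he, Function.update_self]; exact hk
    · rw [Function.update_of_ne he] at hpos ⊢; exact hpos

omit [Fintype V] in
/-- Set algebra of the flipped constraint: `X ∩ Λ = S Δ (D ∩ Λ) ↔ (X Δ D) ∩ Λ = S`. [folklore] -/
theorem inter_eq_symmDiff_iff (X D S Λ : Finset V) :
    X ∩ Λ = S ∆ (D ∩ Λ) ↔ (X ∆ D) ∩ Λ = S := by
  have key : (X ∆ D) ∩ Λ = (X ∩ Λ) ∆ (D ∩ Λ) := by
    ext v
    simp only [Finset.mem_inter, Finset.mem_symmDiff]
    tauto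
  rw [key]
  constructor
  · intro h
    rw [h, symmDiff_assoc, symmDiff_self, symmDiff_bot]
  · intro h
    rw [← h, symmDiff_assoc, symmDiff_self, symmDiff_bot]

/-- **One bond of the insertion map** (ADS15 §3.2, (3.8)–(3.9) for a single bond `e₀ = {a,b}`
of unit coupling): for `β > 0` and a functional `E` with `0 ≤ E ≤ 1` increasing in the trace,
`∑_{∂n ∩ Λ = S} w_β(n) E(n) ≤ tanh(β/2)⁻¹ ∑_{∂n ∩ Λ = S Δ ({a,b} ∩ Λ)} w_β(n) E(n)`. [cite: AizenmanDuminilCopinSidoraviciusCMP2015, §3.2, eq. (3.9)] -/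
theorem tsum_ite_sources_le_of_edge {β : ℝ} (hβ : 0 < β) (Λ S : Finset V) (e₀ : G.edgeFinset)
    {a b : V} (hab : (e₀ : Sym2 V) = s(a, b)) (E : Current G → ℝ) (hE0 : ∀ n, 0 ≤ E n)
    (hE1 : ∀ n, E n ≤ 1) (hEmono : ∀ n n', n.traced ⊆ n'.traced → E n ≤ E n') :
    ∑' n : Current G, (if n.sources ∩ Λ = S then n.weight β * E n else 0) ≤
      (Real.tanh (β / 2))⁻¹ *
        ∑' n : Current G, (if n.sources ∩ Λ = S ∆ ({a, b} ∩ Λ) then n.weight β * E n else 0) := by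
  set R := {r : Current G // r e₀ = 0}
  set F : Finset V → Current G → ℝ := fun T n => if n.sources ∩ Λ = T then n.weight β * E n else 0
    with hF
  have ht : 0 < Real.tanh (β / 2) := Real.tanh_half_pos hβ
  -- summability of the two families
  have hFs : ∀ T, Summable (F T) := by
    intro T
    refine Summable.of_nonneg_of_le (fun n => ?_) (fun n => ?_) (summable_currentWeight_holds G β)
    · simp only [hF]; split_ifs
      · exact mul_nonneg (weight_nonneg hβ.le n) (hE0 n)
      · exact le_rfl
    · simp only [hF]; split_ifs
      · exact mul_le_of_le_one_right (weight_nonneg hβ.le n) (hE1 n)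
      · exact weight_nonneg hβ.le n
  -- reindex by `(r, k) ↦ r with value k on e₀`
  set e' : R × ℕ ≃ Current G := (Equiv.prodComm R ℕ).trans (splitAt e₀).symm with he'
  have he'ap : ∀ (r : R) (k : ℕ), e' (r, k) = Function.update r.1 e₀ k := fun r k => rfl
  have hsum : ∀ T, ∑' n, F T n = ∑' r : R, ∑' k : ℕ, F T (Function.update r.1 e₀ k) := by
    intro T
    rw [← e'.tsum_eq (F T)]
    have hs : Summable (F T ∘ e') := (e'.summable_iff).2 (hFs T)
    exact hs.tsum_prod
  have hsumm : ∀ T, Summable fun r : R => ∑' k : ℕ, F T (Function.update r.1 e₀ k) := by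
    intro T
    have hs : Summable (F T ∘ e') := (e'.summable_iff).2 (hFs T)
    exact hs.prod
  change ∑' n, F S n ≤ (Real.tanh (β / 2))⁻¹ * ∑' n, F (S ∆ ({a, b} ∩ Λ)) n
  rw [hsum, hsum, ← tsum_mul_left]
  refine (hsumm S).tsum_le_tsum (fun r => ?_) ((hsumm _).mul_left _)
  -- the inequality at fixed `r`
  obtain ⟨r, hr⟩ := r
  set P : ℕ → Prop := fun k => sources (Function.update r e₀ k) ∩ Λ = S with hP_def
  set c : ℕ → ℝ := fun k => E (Function.update r e₀ k) with hc_def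
  have hP : ∀ k, P (k + 2) ↔ P k := by
    intro k
    simp only [hP_def]
    rw [sources_update_succ e₀ hab r (k + 1), sources_update_succ e₀ hab r k, symmDiff_assoc,
      symmDiff_self, symmDiff_bot]
  have hP' : ∀ k, sources (Function.update r e₀ k) ∩ Λ = S ∆ ({a, b} ∩ Λ) ↔ P (k + 1) := by
    intro k
    simp only [hP_def]
    rw [sources_update_succ e₀ hab r k]
    exact inter_eq_symmDiff_iff _ _ _ _
  have hc1 : ∀ k, c k ≤ c 1 := by
    intro k
    rcases Nat.eq_zero_or_pos k with rfl | hk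
    · exact hEmono _ _ (traced_mono (update_mono e₀ r zero_le_one))
    · exact hEmono _ _ (traced_update_eq_of_pos e₀ r hk one_pos).subset
  have hc2 : ∀ k, 1 ≤ k → c 1 ≤ c k := fun k hk =>
    hEmono _ _ (traced_update_eq_of_pos e₀ r one_pos hk).subset
  have hl : ∀ k, F S (Function.update r e₀ k) =
      r.weight β * (if P k then β ^ k / (k ! : ℝ) * c k else 0) := by
    intro k
    simp only [hF, hP_def, hc_def]
    split_ifs
    · rw [weight_update e₀ hr]; ring
    · rw [mul_zero]
  have hr' : ∀ k, F (S ∆ ({a, b} ∩ Λ)) (Function.update r e₀ k) =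
      r.weight β * (if P (k + 1) then β ^ k / (k ! : ℝ) * c k else 0) := by
    intro k
    simp only [hF, hc_def]
    by_cases hk : P (k + 1)
    · rw [if_pos ((hP' k).2 hk), if_pos hk, weight_update e₀ hr]; ring
    · rw [if_neg (fun h => hk ((hP' k).1 h)), if_neg hk, mul_zero]
  simp only [hl, hr']
  rw [tsum_mul_left, tsum_mul_left, ← mul_assoc, mul_comm _ (r.weight β), mul_assoc]
  exact mul_le_mul_of_nonneg_left
    (tsum_parity_mul_le hβ P hP c (fun k => hE0 _) hc1 hc2) (weight_nonneg hβ.le r)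

/-- **The insertion map along a walk** (ADS15 §3.2, eqs. (3.8)–(3.9): flipping the parity of
`n` along the bonds `e_0, …, e_{k-1}` of a path `x = x_0, …, x_k = y`, at cost at most
`Γ⁻¹ = ∏_j tanh(β/2)⁻¹` for unit couplings). For `β > 0`, a functional `E` with `0 ≤ E ≤ 1`
increasing in the trace, a walk of length `k` from `x` to `y` in `G`, and any `S`,
`∑_{∂n ∩ Λ = S} w_β(n) E(n) ≤ tanh(β/2)^{-k} ∑_{∂n ∩ Λ = S Δ (({x} Δ {y}) ∩ Λ)} w_β(n) E(n)`;
for `S = {x} Δ {y} ⊆ Λ` the constraint on the right is `∂n ∩ Λ = ∅` ("the source set of `n₂` is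
reset to `∅`"). [cite: AizenmanDuminilCopinSidoraviciusCMP2015, §3.2, eq. (3.9)] -/
theorem tsum_ite_sources_le_of_walk {β : ℝ} (hβ : 0 < β) (Λ : Finset V) (E : Current G → ℝ)
    (hE0 : ∀ n, 0 ≤ E n) (hE1 : ∀ n, E n ≤ 1)
    (hEmono : ∀ n n', n.traced ⊆ n'.traced → E n ≤ E n') {x y : V} (p : G.Walk x y)
    (S : Finset V) :
    ∑' n : Current G, (if n.sources ∩ Λ = S then n.weight β * E n else 0) ≤
      (Real.tanh (β / 2))⁻¹ ^ p.length *
        ∑' n : Current G,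
          (if n.sources ∩ Λ = S ∆ (({x} ∆ {y}) ∩ Λ) then n.weight β * E n else 0) := by
  have ht : 0 ≤ (Real.tanh (β / 2))⁻¹ := inv_nonneg.2 (Real.tanh_half_pos hβ).le
  induction p generalizing S with
  | @nil u =>
    have h0 : S ∆ ((({u} : Finset V) ∆ {u}) ∩ Λ) = S := by
      rw [symmDiff_self, Finset.bot_eq_empty, Finset.empty_inter, ← Finset.bot_eq_empty,
        symmDiff_bot]
    simp only [SimpleGraph.Walk.length_nil, pow_zero, one_mul, h0, le_refl]
  | @cons u w v huw p ih =>
    have hne : u ≠ w := G.ne_of_adj huw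
    set e₀ : G.edgeFinset := ⟨s(u, w), SimpleGraph.mem_edgeFinset.2 huw⟩
    have h1 := tsum_ite_sources_le_of_edge hβ Λ S e₀ (a := u) (b := w) rfl E hE0 hE1 hEmono
    have h2 := ih (S ∆ ({u, w} ∩ Λ))
    have hS : S ∆ ({u, w} ∩ Λ) ∆ (({w} ∆ {v}) ∩ Λ) = S ∆ (({u} ∆ {v}) ∩ Λ) := by
      rw [← symmDiff_singleton_eq_pair hne, symmDiff_assoc,
        show ((({u} : Finset V) ∆ {w}) ∩ Λ) ∆ (({w} ∆ {v}) ∩ Λ) = (({u} ∆ {w}) ∆ ({w} ∆ {v})) ∩ Λ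
          from (inf_symmDiff_distrib_right _ _ _).symm,
        symmDiff_assoc, symmDiff_symmDiff_cancel_left]
    rw [hS] at h2
    rw [SimpleGraph.Walk.length_cons, pow_succ, mul_comm (_ ^ _), mul_assoc]
    exact h1.trans (mul_le_mul_of_nonneg_left h2 ht)

end Current

end Literature.Probability.LatticeModels
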